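import Mathlib

/-!
# Code lift for gadgets of direct pairs — finite-core certificate form (support file)

Item `stmt-MatrixMultiplication-14308` (`FourierTwoFamiliesModP.PrimeTwoFamilies`, CKSU 2005 Conj. 4.7 with
prime cyclic hosts), line `Sketch` (capacity-gadget form of the crux), registered stub `codeLift`.

A GADGET is a list of pairs `(P σ, Q σ)_{σ<r}` of finite subsets of an abelian group `K`, each DIRECT
(`(x - x') + (y - y') = 0 → x = x' ∧ y = y'` inside one pair).  A finite set `W` of words `Fin L → Fin r`
in which every ORDERED pair of distinct words `i ≠ k` has a coordinate `t` where every cross difference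
`q - p` (`p ∈ P (i t)`, `q ∈ Q (k t)`) avoids every diagonal difference `q' - p'` (`p' ∈ P c`, `q' ∈ Q c`,
any letter `c`) lifts to the product blocks `A w = ∏ₜ P (w t)`, `B w = ∏ₜ Q (w t)` (`w ∈ W`) satisfying
the two clauses (W), (X) of the simultaneous double product property verbatim (`codeLift`).

Design (siege variation "certificate on the finite core").  The whole lift is bookkeeping around ONE
finite core: the single-coordinate certificate `(a - a') + (b - b') = 0 ↔ b' - a = b - a'` in an
abelian group (the SDPP relation IS the coincidence of a cross difference with a difference of the middle
block; both sides say `a + b = a' + b'`), together with the coordinate projection of the vector relation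
in `Fin L → K`.  Clause (W) is the letterwise directness `hD` at every coordinate plus `funext`; clause
(X) reads the relation at the separating coordinate through the core, where it is a forbidden
coincidence.  The statement quantifies over an arbitrary abelian group `K`, so there is no `decide`
step: the finite core is certified by the group identity, not by enumeration.  Both auxiliary facts are
local `have`s so that the file declares the registered stub and nothing else.

Not here (other stubs of the line): the carry-free transfer into prime cyclic hosts, the exponent
bookkeeping, the existence of gadgets.  The lead's copy of the same statement lives in
`…Theorems.PrimeTwoFamilies.CapacityLift`; this is an independent proof in its own namespace.
-/

-- single-conjunct summit: the mandated namespace repeats `MatrixMultiplication` (summit = sub-problem).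
set_option linter.dupNamespace false

namespace Summit.MatrixMultiplication.MatrixMultiplication.Theorems.PrimeTwoFamilies.CodeLiftK12

/-- **CODE LIFT** (registered stub `codeLift` of crux `PrimeTwoFamilies`, line `Sketch`).  If every
letter `(P c, Q c)` is direct (`hD`) and `W` is a zero-error code for strong separation (`hW`: for words
`i ≠ k` in `W` some coordinate `t` has every cross difference `q - p`, `p ∈ P (i t)`, `q ∈ Q (k t)`,
distinct from every diagonal difference `q' - p'`, `p' ∈ P c`, `q' ∈ Q c`), then the product blocks
`A w = ∏ₜ P (w t)`, `B w = ∏ₜ Q (w t)` (`w ∈ W`) satisfy clause (W) (first conjunct: coordinatewise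
directness) and clause (X) (second conjunct: at the separating coordinate `t` of the ordered pair
`(i, k)` the relation, read through the finite core, is the forbidden coincidence
`b' t - a t = b t - a' t` with `a' t ∈ P (j t)`, `b t ∈ Q (j t)`). -/
theorem codeLift {K : Type*} [AddCommGroup K] [DecidableEq K] {r L : ℕ}
    (P Q : Fin r → Finset K)
    (hD : ∀ c : Fin r, ∀ x ∈ P c, ∀ x' ∈ P c, ∀ y ∈ Q c, ∀ y' ∈ Q c,
      (x - x') + (y - y') = 0 → x = x' ∧ y = y')
    (W : Finset (Fin L → Fin r))
    (hW : ∀ i ∈ W, ∀ k ∈ W, i ≠ k → ∃ t : Fin L,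
      ∀ p ∈ P (i t), ∀ q ∈ Q (k t), ∀ c : Fin r, ∀ p' ∈ P c, ∀ q' ∈ Q c, q - p ≠ q' - p') :
    (∀ w ∈ W, ∀ a ∈ Fintype.piFinset (fun t => P (w t)), ∀ a' ∈ Fintype.piFinset (fun t => P (w t)),
      ∀ b ∈ Fintype.piFinset (fun t => Q (w t)), ∀ b' ∈ Fintype.piFinset (fun t => Q (w t)),
        (a - a') + (b - b') = 0 → a = a' ∧ b = b') ∧
    (∀ i ∈ W, ∀ j ∈ W, ∀ k ∈ W,
      ∀ a ∈ Fintype.piFinset (fun t => P (i t)), ∀ a' ∈ Fintype.piFinset (fun t => P (j t)),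
      ∀ b ∈ Fintype.piFinset (fun t => Q (j t)), ∀ b' ∈ Fintype.piFinset (fun t => Q (k t)),
        (a - a') + (b - b') = 0 → i = k) := by
  -- THE FINITE CORE (one coordinate, one abelian group): the SDPP relation is the coincidence of the
  -- cross difference `b' - a` with the difference `b - a'`.
  have core : ∀ a a' b b' : K, (a - a') + (b - b') = 0 ↔ b' - a = b - a' := fun a a' b b' => by
    rw [sub_add_sub_comm, sub_eq_zero, sub_eq_sub_iff_add_eq_add, add_comm b' a', add_comm b a]
    exact eq_comm
  -- COORDINATE PROJECTION: the vector relation in `Fin L → K` holds at every coordinate.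
  have coord : ∀ {a a' b b' : Fin L → K}, (a - a') + (b - b') = 0 →
      ∀ t : Fin L, (a t - a' t) + (b t - b' t) = 0 := fun h t => by
    simpa only [Pi.add_apply, Pi.sub_apply, Pi.zero_apply] using congrFun h t
  constructor
  · -- clause (W): the core of each letter is its directness `hD`, applied coordinatewise
    intro w _ a ha a' ha' b hb b' hb' h
    simp only [Fintype.mem_piFinset] at ha ha' hb hb'
    have key : ∀ t, a t = a' t ∧ b t = b' t := fun t =>
      hD (w t) (a t) (ha t) (a' t) (ha' t) (b t) (hb t) (b' t) (hb' t) (coord h t)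
    exact ⟨funext fun t => (key t).1, funext fun t => (key t).2⟩
  · -- clause (X): at the separating coordinate `t` of `(i, k)` the relation is the coincidence
    -- `b' t - a t = b t - a' t` of a cross difference with a diagonal one (letter `j t`): forbidden
    intro i hi j _ k hk a ha a' ha' b hb b' hb' h
    simp only [Fintype.mem_piFinset] at ha ha' hb hb'
    by_contra hik
    obtain ⟨t, ht⟩ := hW i hi k hk hik
    exact ht (a t) (ha t) (b' t) (hb' t) (j t) (a' t) (ha' t) (b t) (hb t)
      ((core (a t) (a' t) (b t) (b' t)).1 (coord h t))

end Summit.MatrixMultiplication.MatrixMultiplication.Theorems.PrimeTwoFamilies.CodeLiftK12
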